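import Summits.Ventures.QEC.Thresholds.CSSFamilyThresholds
import Literature.InformationTheory.QuantumCodes.RotatedSurfaceCodeErasureHalfX
import HarnessLib

/-!
# The rotated surface codes (Surface-17/49/97 family) have qubit-loss threshold EXACTLY `1/2`: census forms

Venture QEC, `Summits/Ventures/QEC/Thresholds/` (LADDER-QEC rung Q5; qec-type-03 gen 6, item 03.RSCHALF). Packaging of
`Literature/InformationTheory/QuantumCodes/RotatedSurfaceCodeErasureHalf(X).lean` for the census family
`fun L => RotatedSurface.code (L + 1)` of type-08's rotated surface codes `RSC(L) = [[L², 1, L]]` (`RotatedSurfaceCode.lean`;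
`RSC(3)`, `RSC(5)`, `RSC(7)` are the census objects Surface-17/49/97, `RotatedSurface.surface17_isCode` …) in the cell's
`zErasureFamily` / `xErasureFamily` vocabulary (`CSSFamilyThresholds.lean`): BOTH sectors have loss accuracy threshold
EXACTLY `1/2` — floor from Kesten's theorem through the medial-lattice one-arm events, ceiling from the no-cloning sum rule
`y_c^Z + y_c^X ≤ 1` (`k = 1`). UNCONDITIONAL, 0 named facts; no parity restriction on `L`. In print the value `1/2` is
Stace–Barrett–Doherty's percolation identification for the (toric) surface code; for the rotated planar patch it is folklore
/ numerics.

## References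

* [StaceBarrettDoherty2009] T. M. Stace, S. D. Barrett, A. C. Doherty, PRL 102 (2009) 200501, p. 1 (abstract: "the maximum
  tolerable loss rate is 50%"), p. 2–3.
* [BombinMartinDelgado2007Optimal] H. Bombin, M. A. Martin-Delgado, PRA 76 (2007) 012305, §IV (rotated planar codes).
* [TomitaSvore2014] Y. Tomita, K. M. Svore, PRA 90 (2014) 062320, §2.2 (Surface-17).
* [KestenCMP1980] H. Kesten, Comm. Math. Phys. 74 (1980) 41–59, Thm. 1, Thm. 2 (1.7).
-/

noncomputable section

namespace Summit.Ventures.QEC.Thresholds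

open Filter Topology Matrix
open Literature.InformationTheory.QuantumCodes

/-! ### Census forms: both sectors of `fun L => RotatedSurface.code (L + 1)` -/

/-- The census `Z`-sector erasure family of the rotated surface codes IS the family of `RotatedSurfaceCodeErasureHalf.lean`
(definitional). [cite: StaceBarrettDoherty2009, p. 2 (loss criterion: the lost qubits support a logical operator)] -/
theorem rotatedSurface_zErasureFamily_eq :
    zErasureFamily (fun L => RotatedSurface.code (L + 1)) = fun L y => ErasureDecoder.uncorrectableProb
      {x : Fin (L + 1) × Fin (L + 1) → ZMod 2 | (RotatedSurface.code (L + 1)).HX *ᵥ x = 0}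
      ((RotatedSurface.code (L + 1)).rowSpZ : Set (Fin (L + 1) × Fin (L + 1) → ZMod 2)) y := rfl

/-- The census `X`-sector erasure family of the rotated surface codes (definitional). [cite: StaceBarrettDoherty2009, p. 2] -/
theorem rotatedSurface_xErasureFamily_eq :
    xErasureFamily (fun L => RotatedSurface.code (L + 1)) = fun L y => ErasureDecoder.uncorrectableProb
      {x : Fin (L + 1) × Fin (L + 1) → ZMod 2 | (RotatedSurface.code (L + 1)).HZ *ᵥ x = 0}
      ((RotatedSurface.code (L + 1)).rowSpX : Set (Fin (L + 1) × Fin (L + 1) → ZMod 2)) y := rfl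

/-- ★ **`Z`-sector loss threshold of the rotated surface codes = `1/2` exactly** (census form; the family passes through
Surface-17 = `RotatedSurface.code 3`, Surface-49, Surface-97). [cite: StaceBarrettDoherty2009, p. 1 (abstract)] [cite: KestenCMP1980, Thm. 1] -/
theorem rotatedSurface_z_erasure_accuracyThreshold_eq_half :
    accuracyThreshold (zErasureFamily (fun L => RotatedSurface.code (L + 1))) = 1 / 2 := by
  rw [rotatedSurface_zErasureFamily_eq]
  exact RotatedSurface.z_loss_accuracyThreshold_eq_half

/-- ★ **`X`-sector loss threshold of the rotated surface codes = `1/2` exactly** (census form).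
[cite: StaceBarrettDoherty2009, p. 1 (abstract)] [cite: KestenCMP1980, Thm. 1] -/
theorem rotatedSurface_x_erasure_accuracyThreshold_eq_half :
    accuracyThreshold (xErasureFamily (fun L => RotatedSurface.code (L + 1))) = 1 / 2 := by
  rw [rotatedSurface_xErasureFamily_eq]
  exact RotatedSurface.x_loss_accuracyThreshold_eq_half

/-- `Z`-sector floor in `IsThresholdLowerBound` form: every loss rate `< 1/2` is below threshold.
[cite: StaceBarrettDoherty2009, p. 2–3 (for p_loss < 0.5 loss recovery almost surely succeeds)] -/
theorem rotatedSurface_z_lossThreshold_half :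
    IsThresholdLowerBound (zErasureFamily (fun L => RotatedSurface.code (L + 1))) (1 / 2) := by
  rw [rotatedSurface_zErasureFamily_eq]
  exact RotatedSurface.z_lossThreshold_half

/-- `X`-sector floor in `IsThresholdLowerBound` form. [cite: StaceBarrettDoherty2009, p. 2–3] -/
theorem rotatedSurface_x_lossThreshold_half :
    IsThresholdLowerBound (xErasureFamily (fun L => RotatedSurface.code (L + 1))) (1 / 2) := by
  rw [rotatedSurface_xErasureFamily_eq]
  exact RotatedSurface.x_lossThreshold_half

/-- Ceiling in `IsThresholdLowerBound` form: NO certified `Z`-sector loss threshold of the rotated surface codes exceeds `1/2`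
(for any decoder — the statement is about uncorrectability). [cite: StaceBarrettDoherty2009, p. 1 (abstract: maximum tolerable loss rate 50%)] -/
theorem rotatedSurface_z_lossThreshold_le_half {a : ℝ}
    (ha : IsThresholdLowerBound (zErasureFamily (fun L => RotatedSurface.code (L + 1))) a) : a ≤ 1 / 2 := by
  rw [rotatedSurface_zErasureFamily_eq] at ha
  exact RotatedSurface.z_lossThreshold_le_half ha

/-- **Both sectors at once** (the census sentence): the rotated surface code family has qubit-loss accuracy threshold
`1/2` in the `Z` sector AND in the `X` sector. [cite: StaceBarrettDoherty2009, p. 1 (abstract)] [cite: KestenCMP1980, Thm. 1] -/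
theorem rotatedSurface_loss_accuracyThreshold_eq_half_bothSectors :
    accuracyThreshold (zErasureFamily (fun L => RotatedSurface.code (L + 1))) = 1 / 2 ∧
      accuracyThreshold (xErasureFamily (fun L => RotatedSurface.code (L + 1))) = 1 / 2 :=
  ⟨rotatedSurface_z_erasure_accuracyThreshold_eq_half, rotatedSurface_x_erasure_accuracyThreshold_eq_half⟩

/-! ### Code-capacity error thresholds of the rotated surface codes (census rows; DKLP/DKP counting, `w = 4`) -/

/-- The row indices of an `X`-face have at most two values. [cite: TomitaSvore2014, §2.2 (weight-4 and weight-2 stabilizers)] -/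
private theorem card_filter_pair_le {L : ℕ} (P : ℕ → Prop) [DecidablePred P] (a b : ℕ) (hP : ∀ n, P n → n = a ∨ n = b) :
    ((Finset.univ : Finset (Fin L)).filter fun i => P i.val).card ≤ 2 := by
  classical
  calc ((Finset.univ : Finset (Fin L)).filter fun i => P i.val).card
      = (((Finset.univ : Finset (Fin L)).filter fun i => P i.val).image Fin.val).card :=
        (Finset.card_image_of_injective _ Fin.val_injective).symm
    _ ≤ ({a, b} : Finset ℕ).card := by
        refine Finset.card_le_card fun n hn => ?_
        obtain ⟨i, hi, rfl⟩ := Finset.mem_image.1 hn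
        rcases hP _ (Finset.mem_filter.1 hi).2 with h | h
        · rw [h]; exact Finset.mem_insert_self _ _
        · rw [h]; exact Finset.mem_insert_of_mem (Finset.mem_singleton_self _)
    _ ≤ 2 := Finset.card_le_two

/-- **The `X`-checks of `RSC(L)` have weight `≤ 4`.** [cite: TomitaSvore2014, §2.2 (p0004 L45-59: weight-4 and weight-2 stabilizers)] -/
theorem rotatedSurface_card_rowSupp_HX_le (L : ℕ) (x : Fin (L + 1) × Fin (L - 1)) :
    (rowSupp (RotatedSurface.HX L) x).card ≤ 4 := by
  classical
  set A := (Finset.univ : Finset (Fin L)).filter fun i => (fun n => n + 1 = x.1.val ∨ n = x.1.val) i.val with hA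
  set B := (Finset.univ : Finset (Fin L)).filter fun j => (fun n => n = x.2.val ∨ n = x.2.val + 1) j.val with hB
  have hsub : rowSupp (RotatedSurface.HX L) x ⊆ A ×ˢ B := by
    intro q hq
    rw [rowSupp, Finset.mem_filter] at hq
    have hr : RotatedSurface.rx x q.1 ≠ 0 := left_ne_zero_of_mul (right_ne_zero_of_mul hq.2)
    have hc : RotatedSurface.cx x q.2 ≠ 0 := right_ne_zero_of_mul (right_ne_zero_of_mul hq.2)
    simp only [RotatedSurface.rx, ne_eq, ite_eq_right_iff, one_ne_zero, imp_false, not_not] at hr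
    simp only [RotatedSurface.cx, ne_eq, ite_eq_right_iff, one_ne_zero, imp_false, not_not] at hc
    exact Finset.mem_product.2 ⟨Finset.mem_filter.2 ⟨Finset.mem_univ _, hr⟩, Finset.mem_filter.2 ⟨Finset.mem_univ _, hc⟩⟩
  have hA2 : A.card ≤ 2 :=
    card_filter_pair_le (fun n => n + 1 = x.1.val ∨ n = x.1.val) (x.1.val - 1) x.1.val (fun n hn => by omega)
  have hB2 : B.card ≤ 2 := card_filter_pair_le _ x.2.val (x.2.val + 1) (fun n hn => by omega)
  calc (rowSupp (RotatedSurface.HX L) x).card ≤ (A ×ˢ B).card := Finset.card_le_card hsub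
    _ = A.card * B.card := Finset.card_product _ _
    _ ≤ 2 * 2 := Nat.mul_le_mul hA2 hB2

/-- **The `Z`-checks of `RSC(L)` have weight `≤ 4`.** [cite: TomitaSvore2014, §2.2 (p0004 L45-59)] -/
theorem rotatedSurface_card_rowSupp_HZ_le (L : ℕ) (z : Fin (L - 1) × Fin (L + 1)) :
    (rowSupp (RotatedSurface.HZ L) z).card ≤ 4 := by
  classical
  set A := (Finset.univ : Finset (Fin L)).filter fun i => (fun n => n = z.1.val ∨ n = z.1.val + 1) i.val with hA
  set B := (Finset.univ : Finset (Fin L)).filter fun j => (fun n => n + 1 = z.2.val ∨ n = z.2.val) j.val with hB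
  have hsub : rowSupp (RotatedSurface.HZ L) z ⊆ A ×ˢ B := by
    intro q hq
    rw [rowSupp, Finset.mem_filter] at hq
    have hr : RotatedSurface.rz z q.1 ≠ 0 := left_ne_zero_of_mul (right_ne_zero_of_mul hq.2)
    have hc : RotatedSurface.cz z q.2 ≠ 0 := right_ne_zero_of_mul (right_ne_zero_of_mul hq.2)
    simp only [RotatedSurface.rz, ne_eq, ite_eq_right_iff, one_ne_zero, imp_false, not_not] at hr
    simp only [RotatedSurface.cz, ne_eq, ite_eq_right_iff, one_ne_zero, imp_false, not_not] at hc
    exact Finset.mem_product.2 ⟨Finset.mem_filter.2 ⟨Finset.mem_univ _, hr⟩, Finset.mem_filter.2 ⟨Finset.mem_univ _, hc⟩⟩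
  have hA2 : A.card ≤ 2 := card_filter_pair_le _ z.1.val (z.1.val + 1) (fun n hn => by omega)
  have hB2 : B.card ≤ 2 :=
    card_filter_pair_le (fun n => n + 1 = z.2.val ∨ n = z.2.val) (z.2.val - 1) z.2.val (fun n hn => by omega)
  calc (rowSupp (RotatedSurface.HZ L) z).card ≤ (A ×ˢ B).card := Finset.card_le_card hsub
    _ = A.card * B.card := Finset.card_product _ _
    _ ≤ 2 * 2 := Nat.mul_le_mul hA2 hB2

/-- Size subexponential in the distance: `(L+1)² r^{L+1} → 0` for `0 < r < 1`. [cite: DumerKovalevPryadko2015, Thm 2 (d ≥ D ln n)] -/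
private theorem rotatedSurface_growth (r : ℝ) (hr0 : 0 < r) (hr1 : r < 1) :
    Tendsto (fun L : ℕ => (Fintype.card (Fin (L + 1) × Fin (L + 1)) : ℝ) * r ^ (L + 1)) atTop (𝓝 0) := by
  have h0 := tendsto_pow_const_mul_const_pow_of_abs_lt_one 2 (show |r| < 1 by rwa [abs_of_pos hr0])
  have h1 : Tendsto (fun L : ℕ => ((L + 1 : ℕ) : ℝ) ^ 2 * r ^ (L + 1)) atTop (𝓝 0) :=
    (Filter.tendsto_add_atTop_iff_nat 1).2 h0
  refine h1.congr fun L => ?_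
  simp [sq]

/-- **`Z`-sector code-capacity threshold of the rotated surface codes `≥ p₀(3) ≈ .0286`** (family `fun L => code (L + 1)`;
independent `Z`-errors of rate `p`, perfect syndromes, EVERY family of minimum-weight decoders): every `0 ≤ p < p₀(3)` is below
threshold — checks of weight `≤ 4`, distance `L + 1`, `(L+1)²` qubits. UNCONDITIONAL. [cite: DumerKovalevPryadko2015, Thm 2 (y = 0, w = 4)] [cite: DennisEtAl2002, §5.3 (p₀(3))] -/
theorem rotatedSurface_z_isThresholdLowerBound_three
    (D : ∀ L, Decoder (Fin (L + 1 + 1) × Fin (L + 1 - 1) → ZMod 2) (Fin (L + 1) × Fin (L + 1) → ZMod 2))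
    (hD : ∀ L, (D L).IsMinWeight (RotatedSurface.code (L + 1)).zSyndrome
      ((RotatedSurface.code (L + 1)).kerX : Set (Fin (L + 1) × Fin (L + 1) → ZMod 2)) hammingNorm) :
    IsThresholdLowerBound (zFailureFamily (fun L => RotatedSurface.code (L + 1)) D) (thresholdValue 3) := by
  have h := z_isThresholdLowerBound_of_rowWeight (fun L => RotatedSurface.code (L + 1)) D hD (w := 4) (by norm_num)
    (fun L x => rotatedSurface_card_rowSupp_HX_le (L + 1) x) (fun L => L + 1) (fun L => Nat.succ_pos L)
    (fun L x hx hxS => by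
      have h := (RotatedSurface.code (L + 1)).dZ_le_hammingNorm hx hxS
      rwa [RotatedSurface.code_dZ (Nat.succ_pos L)] at h)
    (fun r hr0 hr1 => rotatedSurface_growth r hr0 hr1)
  norm_num at h
  exact h

/-- **`X`-sector code-capacity threshold of the rotated surface codes `≥ p₀(3)`** (bit flips, EVERY minimum-weight decoder
family). UNCONDITIONAL. [cite: DumerKovalevPryadko2015, Thm 2 (y = 0, w = 4)] [cite: DennisEtAl2002, §5.3 (p₀(3))] -/
theorem rotatedSurface_x_isThresholdLowerBound_three
    (D : ∀ L, Decoder (Fin (L + 1 - 1) × Fin (L + 1 + 1) → ZMod 2) (Fin (L + 1) × Fin (L + 1) → ZMod 2))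
    (hD : ∀ L, (D L).IsMinWeight (RotatedSurface.code (L + 1)).xSyndrome
      ((RotatedSurface.code (L + 1)).kerZ : Set (Fin (L + 1) × Fin (L + 1) → ZMod 2)) hammingNorm) :
    IsThresholdLowerBound (xFailureFamily (fun L => RotatedSurface.code (L + 1)) D) (thresholdValue 3) := by
  have h := x_isThresholdLowerBound_of_rowWeight (fun L => RotatedSurface.code (L + 1)) D hD (w := 4) (by norm_num)
    (fun L z => rotatedSurface_card_rowSupp_HZ_le (L + 1) z) (fun L => L + 1) (fun L => Nat.succ_pos L)
    (fun L x hx hxS => by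
      have h := (RotatedSurface.code (L + 1)).dX_le_hammingNorm hx hxS
      rwa [RotatedSurface.code_dX (Nat.succ_pos L)] at h)
    (fun r hr0 hr1 => rotatedSurface_growth r hr0 hr1)
  norm_num at h
  exact h

/-- **Decimal form**: `p_c > .0285` for the `Z` sector of the rotated surface codes, every minimum-weight decoder family
(`p₀(3) > .0285`, `thresholdValue_three_bounds`). [cite: DennisEtAl2002, §5.3 (p₀(3) = .0286 numerically)] -/
theorem rotatedSurface_z_accuracyThreshold_gt_0285
    (D : ∀ L, Decoder (Fin (L + 1 + 1) × Fin (L + 1 - 1) → ZMod 2) (Fin (L + 1) × Fin (L + 1) → ZMod 2))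
    (hD : ∀ L, (D L).IsMinWeight (RotatedSurface.code (L + 1)).zSyndrome
      ((RotatedSurface.code (L + 1)).kerX : Set (Fin (L + 1) × Fin (L + 1) → ZMod 2)) hammingNorm) :
    (0.0285 : ℝ) < accuracyThreshold (zFailureFamily (fun L => RotatedSurface.code (L + 1)) D) :=
  lt_of_lt_of_le thresholdValue_three_bounds.1 (le_accuracyThreshold (rotatedSurface_z_isThresholdLowerBound_three D hD)
    (thresholdValue_three_bounds.2.le.trans (by norm_num)))

/-- **Decimal form, `X` sector**: `p_c > .0285`, every minimum-weight decoder family. [cite: DennisEtAl2002, §5.3] -/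
theorem rotatedSurface_x_accuracyThreshold_gt_0285
    (D : ∀ L, Decoder (Fin (L + 1 - 1) × Fin (L + 1 + 1) → ZMod 2) (Fin (L + 1) × Fin (L + 1) → ZMod 2))
    (hD : ∀ L, (D L).IsMinWeight (RotatedSurface.code (L + 1)).xSyndrome
      ((RotatedSurface.code (L + 1)).kerZ : Set (Fin (L + 1) × Fin (L + 1) → ZMod 2)) hammingNorm) :
    (0.0285 : ℝ) < accuracyThreshold (xFailureFamily (fun L => RotatedSurface.code (L + 1)) D) :=
  lt_of_lt_of_le thresholdValue_three_bounds.1 (le_accuracyThreshold (rotatedSurface_x_isThresholdLowerBound_three D hD)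
    (thresholdValue_three_bounds.2.le.trans (by norm_num)))

end Summit.Ventures.QEC.Thresholds
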